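import Summits.Parity.GeneralizedHardyLittlewood.Theorems.PrimeLevelFamEdgeMomentsBeyondDiagonalFirstOrderOffDiagBound
import HarnessLib

/-!
# The twisted harmonic first moment of `Λ^{(k)}(f,½)` at prime level, every order `k` (Bettin's range `m ≤ N`)
# (helper for crux K_A `PrimeLevelFamEdge.MomentsBeyondDiagonal`, stmt-Parity-20007, stub `stub_first : SubFirst` ∀`Q`)

**Theorem (`harmonicSum_heckeLambda_mul_derivLambda_sub_le`).** For every `k` there is `C_k` such that for all primes `N`
and all `1 ≤ m ≤ N`:
`‖Σʰ_{f ∈ S₂(N)^*} λ_f(m) Λ^{(k)}(f,½) − q̂^{1/2} m^{−1/2} ∫_{2π/N²}^∞ e^{−x}(log(q̂/m) + log x)^k dx‖ ≤ C_k (1 + log N)^{k+4} q̂^{1/2} √m / N`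
— the order-`k` analogue of Bettin 2017, Thm. 1.1 (`k = 0`: main term `q̂^{1/2} m^{−1/2}`, error `m^{1/2}N^{−1+ε}`), by the
unbalanced split at `y = 1/(mN²)` (`…FirstOrderUnbalanced`), the height-integrated off-diagonal (`…FirstOrderOffDiagBound`)
and the exponentially small dual piece (§1 here, `Y = mN`). §2 evaluates the diagonal `2π q̂^{1/2} √m I_k(m,y)` by the
substitution `x = 2πm v` (`integral_Ioi_exp_comp_logWeight`). Proof only; no definition; nothing about Landau–Siegel zeros;
K_A NOT proved.
-/

noncomputable section

open scoped Real
open Complex Set MeasureTheory Filter Topology Finset CongruenceSubgroup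
open Literature.NumberTheory.EllipticCurves.ModularForms
open Literature.NumberTheory.LFunctions Literature.NumberTheory.LFunctions.KMV2000
open Literature.NumberTheory.LFunctions.KowalskiMichel2000

namespace Summit.Parity.GeneralizedHardyLittlewood.Theorems.MomentsBeyondDiagonal.FirstOrderAFE

/-! ## §1. The dual piece is exponentially small -/

set_option maxHeartbeats 400000 in
/-- **The dual piece** (`N` prime, `1 ≤ m ≤ N`, height `Y = (N·(1/(mN²)))⁻¹ = mN ≥ 1`):
`‖Σ_n √(Nn)·pet(m,Nn)·I_k(n,Y)‖ ≤ C_k (1 + log N)^k √m / N` (termwise: Petersson + `‖J(m,Nn)‖ ≤ K m √n`,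
`I_k(n,Y) ≤ e^{−2π(n−1)Y} ∫_Y^∞ e^{−2πt}(log √N t)^k ≤ e^{−2π(n−1)} 2^k((log √N)^k + k!/π^k) e^{−πY}/π`, `Σ n rⁿ ≤ 4r`,
`(mN)³e^{−πmN} ≤ 6/π³`). [cite: Bettin2017, Lemma 2.1] [cite: KowalskiMichel2000, §2.4.2 p. 312] -/
theorem norm_tsum_dual_axisWeight_le (k : ℕ) :
    ∃ C : ℝ, 0 ≤ C ∧ ∀ (N : ℕ) [NeZero N], N.Prime → ∀ m : ℕ, 1 ≤ m → m ≤ N →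
      ‖∑' n : ℕ, ((Real.sqrt ((N : ℝ) * n) : ℝ) : ℂ) * pet N m (N * n) *
          ((∫ v in Ioi (((N : ℝ) * (1 / ((m : ℝ) * (N : ℝ) ^ 2)))⁻¹), Real.exp (-(2 * Real.pi * n) * v) *
            (Real.log (Real.sqrt N * v)) ^ k : ℝ) : ℂ)‖ ≤
        C * (1 + Real.log N) ^ k * Real.sqrt m / N := by
  obtain ⟨K, hK0, hK⟩ := norm_petJ_level_mul_le
  refine ⟨4 * (1 + K) * (2 ^ k * (1 + (k.factorial : ℝ))), by positivity, fun N _ hN m hm hmN ↦ ?_⟩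
  have hN2 : (2 : ℝ) ≤ N := by exact_mod_cast hN.two_le
  have hN0 : (0 : ℝ) < N := by linarith
  have hN1 : (1 : ℝ) ≤ N := by linarith
  have hm1 : (1 : ℝ) ≤ m := by exact_mod_cast hm
  have hm0 : (0 : ℝ) < m := by linarith
  have hmN' : (m : ℝ) ≤ N := by exact_mod_cast hmN
  set L : ℝ := Real.log N with hL
  have hL0 : 0 < L := Real.log_pos (by linarith)
  -- the height `Y = mN ≥ 1`
  have hY : ((N : ℝ) * (1 / ((m : ℝ) * (N : ℝ) ^ 2)))⁻¹ = (m : ℝ) * N := by field_simp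
  rw [hY]
  have hY1 : (1 : ℝ) ≤ (m : ℝ) * N := by nlinarith
  have hY0 : (0 : ℝ) < (m : ℝ) * N := by positivity
  -- the tail constant
  set T : ℝ := 2 ^ k * ((Real.log (Real.sqrt N)) ^ k + (k.factorial : ℝ) / π ^ k) *
    (Real.exp (-(π * ((m : ℝ) * N))) / π) with hT
  have hlogN0 : 0 ≤ Real.log (Real.sqrt N) := log_sqrt_nonneg (N := N)
  have hT0 : 0 ≤ T := by positivity
  -- `r = e^{-2π}`
  set r : ℝ := Real.exp (-(2 * π)) with hr
  have hr0 : 0 < r := Real.exp_pos _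
  have hr12 : r ≤ 1 / 2 := by
    have h2 : (2 : ℝ) ≤ Real.exp 1 := by linarith [Real.add_one_le_exp (1 : ℝ)]
    exact (Real.exp_le_exp.mpr (by linarith [Real.pi_gt_three] : -(2 * π) ≤ -1)).trans
      (by rw [Real.exp_neg, one_div]; exact inv_anti₀ (by norm_num) h2)
  have hr1 : ‖r‖ < 1 := by rw [Real.norm_of_nonneg hr0.le]; linarith
  set A : ℝ := Real.sqrt N * ((1 + K) * m) * T * Real.exp (2 * π) with hA
  have hA0 : 0 ≤ A := by positivity
  have hG : HasSum (fun n : ℕ ↦ A * (n * r ^ n)) (A * (r / (1 - r) ^ 2)) :=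
    (hasSum_coe_mul_geometric_of_norm_lt_one hr1).mul_left A
  -- termwise bound
  have hbound : ∀ n : ℕ, ‖((Real.sqrt ((N : ℝ) * n) : ℝ) : ℂ) * pet N m (N * n) *
      ((∫ v in Ioi ((m : ℝ) * N), Real.exp (-(2 * Real.pi * n) * v) * (Real.log (Real.sqrt N * v)) ^ k : ℝ) : ℂ)‖ ≤
      A * (n * r ^ n) := by
    intro n
    rcases Nat.eq_zero_or_pos n with rfl | hn
    · simp
    have hn1 : (1 : ℝ) ≤ n := by exact_mod_cast hn
    have hn0 : (0 : ℝ) < n := by linarith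
    -- Petersson: `√n ‖pet(m, Nn)‖ ≤ √n (1 + K m √n) ≤ (1+K) m n`
    have hcomb : Real.sqrt n * ‖pet N m (N * n)‖ ≤ (1 + K) * m * n := by
      have h := (kowalskiMichel2000_peterssonFormula_holds N hN m (N * n) hm
        (Nat.one_le_iff_ne_zero.mpr (mul_ne_zero hN.ne_zero hn.ne'))).2
      have hpet : ‖pet N m (N * n)‖ ≤ 1 + K * m * Real.sqrt n := by
        rw [h]
        have h1 : ‖((if m = N * n then 1 else 0 : ℂ))‖ ≤ 1 := by split_ifs <;> simp
        exact (norm_sub_le _ _).trans (add_le_add h1 (hK N hN m n hm))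
      have hsq : Real.sqrt n ≤ n := by rw [Real.sqrt_le_left hn0.le]; nlinarith
      have hss : Real.sqrt n * Real.sqrt n = n := Real.mul_self_sqrt hn0.le
      calc Real.sqrt n * ‖pet N m (N * n)‖ ≤ Real.sqrt n * (1 + K * m * Real.sqrt n) :=
            mul_le_mul_of_nonneg_left hpet (Real.sqrt_nonneg _)
        _ = Real.sqrt n + K * m * (Real.sqrt n * Real.sqrt n) := by ring
        _ ≤ n * m + K * m * n := by rw [hss]; nlinarith
        _ = (1 + K) * m * n := by ring
    -- the integral: `0 ≤ I_k(n, Y) ≤ e^{-2π(n-1)Y} ∫_Y^∞ e^{-2πt}(log √N t)^k ≤ e^{-2π(n-1)} T`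
    have hint_n : IntegrableOn (fun v : ℝ ↦ Real.exp (-(2 * Real.pi * n) * v) * (Real.log (Real.sqrt N * v)) ^ k)
        (Ioi ((m : ℝ) * N)) := by
      have hmaj := integrableOn_exp_abs_logPow_Ioi (N := N) k hY0.le
      refine Integrable.mono' hmaj ?_ ?_
      · refine (ContinuousOn.mul (by fun_prop) ((ContinuousOn.pow ?_ k))).aestronglyMeasurable measurableSet_Ioi
        exact Real.continuousOn_log.comp (by fun_prop) fun v hv ↦
          (mul_pos (Real.sqrt_pos.mpr hN0) (hY0.trans hv)).ne'
      · refine (ae_restrict_iff' measurableSet_Ioi).mpr (Filter.Eventually.of_forall fun v hv ↦ ?_)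
        have hv : (m : ℝ) * N < v := hv
        have hv1 : 1 ≤ v := hY1.trans hv.le
        rw [norm_mul, Real.norm_of_nonneg (Real.exp_pos _).le, norm_pow, Real.norm_eq_abs]
        refine mul_le_mul_of_nonneg_right (Real.exp_le_exp.mpr ?_) (by positivity)
        nlinarith [mul_nonneg (mul_nonneg Real.pi_pos.le (by linarith : (0 : ℝ) ≤ n - 1)) (by linarith : (0 : ℝ) ≤ v)]
    have hI_le : ∫ v in Ioi ((m : ℝ) * N), Real.exp (-(2 * Real.pi * n) * v) * (Real.log (Real.sqrt N * v)) ^ k ≤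
        Real.exp (-(2 * π * (n - 1))) * T := by
      have hmono : ∫ v in Ioi ((m : ℝ) * N), Real.exp (-(2 * Real.pi * n) * v) * (Real.log (Real.sqrt N * v)) ^ k ≤
          ∫ v in Ioi ((m : ℝ) * N), Real.exp (-(2 * π * (n - 1))) *
            (Real.exp (-(2 * π * v)) * (Real.log (Real.sqrt N * v)) ^ k) := by
        refine setIntegral_mono_on hint_n ?_ measurableSet_Ioi fun v hv ↦ ?_
        · have h := (integrableOn_exp_abs_logPow_Ioi (N := N) k hY0.le).const_mul (Real.exp (-(2 * π * (n - 1))))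
          refine IntegrableOn.congr_fun h (fun v hv ↦ ?_) measurableSet_Ioi
          have hv1 : 1 ≤ v := hY1.trans (le_of_lt hv)
          rw [abs_of_nonneg (log_sqrt_mul_bounds (N := N) hv1).1]
        · have hv : (m : ℝ) * N < v := hv
          have hv1 : 1 ≤ v := hY1.trans hv.le
          have hl0 := (log_sqrt_mul_bounds (N := N) hv1).1
          rw [← mul_assoc, ← Real.exp_add]
          refine mul_le_mul_of_nonneg_right (Real.exp_le_exp.mpr ?_) (pow_nonneg hl0 k)
          nlinarith [Real.pi_pos, mul_nonneg (by linarith : (0 : ℝ) ≤ n - 1) (by linarith : (0 : ℝ) ≤ v - 1)]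
      refine hmono.trans ?_
      rw [integral_const_mul]
      exact mul_le_mul_of_nonneg_left (integral_exp_mul_logPow_tail_le (N := N) hY1 k) (Real.exp_pos _).le
    have hI0 : 0 ≤ ∫ v in Ioi ((m : ℝ) * N), Real.exp (-(2 * Real.pi * n) * v) * (Real.log (Real.sqrt N * v)) ^ k :=
      setIntegral_nonneg measurableSet_Ioi fun v hv ↦ mul_nonneg (Real.exp_pos _).le
        (pow_nonneg (log_sqrt_mul_bounds (N := N) (hY1.trans (le_of_lt hv))).1 k)
    have hexp : Real.exp (-(2 * π * (n - 1))) = Real.exp (2 * π) * r ^ n := by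
      rw [hr, ← Real.exp_nat_mul, ← Real.exp_add]; congr 1; ring
    rw [norm_mul, norm_mul, Complex.norm_real, Complex.norm_real, Real.norm_of_nonneg (Real.sqrt_nonneg _),
      Real.norm_of_nonneg hI0, Real.sqrt_mul hN0.le]
    calc Real.sqrt N * Real.sqrt n * ‖pet N m (N * n)‖ *
          ∫ v in Ioi ((m : ℝ) * N), Real.exp (-(2 * Real.pi * n) * v) * (Real.log (Real.sqrt N * v)) ^ k
        = Real.sqrt N * (Real.sqrt n * ‖pet N m (N * n)‖) *
          ∫ v in Ioi ((m : ℝ) * N), Real.exp (-(2 * Real.pi * n) * v) * (Real.log (Real.sqrt N * v)) ^ k := by ring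
      _ ≤ Real.sqrt N * ((1 + K) * m * n) * (Real.exp (-(2 * π * (n - 1))) * T) := by gcongr
      _ = A * (n * r ^ n) := by rw [hexp, hA]; ring
  -- sum the majorant: `Σ n rⁿ = r/(1-r)² ≤ 4r`
  have hle := tsum_of_norm_bounded hG hbound
  refine hle.trans ?_
  have hgeom : r / (1 - r) ^ 2 ≤ 4 * r := by
    have hpos : (0 : ℝ) < (1 - r) ^ 2 := pow_pos (by linarith) 2
    rw [div_le_iff₀ hpos]
    nlinarith [mul_nonneg hr0.le (by nlinarith : (0 : ℝ) ≤ 4 * (1 - r) ^ 2 - 1)]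
  -- `T ≤ 2^k (1 + k!) (1+L)^k e^{-πmN}` and `√N m e^{-πmN} ≤ √m/N`
  have hlogN : Real.log (Real.sqrt N) = L / 2 := by rw [Real.log_sqrt hN0.le, hL]
  have h1L : (1 : ℝ) ≤ 1 + L := by linarith
  have hT1 : T ≤ 2 ^ k * (1 + (k.factorial : ℝ)) * (1 + L) ^ k * Real.exp (-(π * ((m : ℝ) * N))) := by
    have hA' : (Real.log (Real.sqrt N)) ^ k ≤ (1 + L) ^ k := by
      rw [hlogN]; exact pow_le_pow_left₀ (by positivity) (by linarith) _
    have hB' : (k.factorial : ℝ) / π ^ k ≤ (k.factorial : ℝ) * (1 + L) ^ k :=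
      (div_le_self (by positivity) (one_le_pow₀ (by linarith [Real.pi_gt_three]))).trans
        (le_mul_of_one_le_right (by positivity) (one_le_pow₀ h1L))
    have hC' : Real.exp (-(π * ((m : ℝ) * N))) / π ≤ Real.exp (-(π * ((m : ℝ) * N))) :=
      div_le_self (Real.exp_pos _).le (by linarith [Real.pi_gt_three])
    calc T = 2 ^ k * ((Real.log (Real.sqrt N)) ^ k + (k.factorial : ℝ) / π ^ k) *
          (Real.exp (-(π * ((m : ℝ) * N))) / π) := hT
      _ ≤ 2 ^ k * ((1 + L) ^ k + (k.factorial : ℝ) * (1 + L) ^ k) * Real.exp (-(π * ((m : ℝ) * N))) := by gcongr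
      _ = _ := by ring
  have hexp_small : Real.sqrt N * m * Real.exp (-(π * ((m : ℝ) * N))) ≤ Real.sqrt m / N := by
    have h3 := pow_mul_exp_neg_pi_le 3 hY0.le
    have hfac : ((Nat.factorial 3 : ℕ) : ℝ) / π ^ 3 ≤ 1 := by
      have h27 : (3 : ℝ) ^ 3 ≤ π ^ 3 := pow_le_pow_left₀ (by norm_num) Real.pi_gt_three.le 3
      rw [div_le_one (by positivity)]; norm_num [Nat.factorial] at h27 ⊢; linarith
    have hE : Real.exp (-(π * ((m : ℝ) * N))) ≤ 1 / ((m : ℝ) * N) ^ 3 := by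
      rw [le_div_iff₀ (by positivity)]
      calc Real.exp (-(π * ((m : ℝ) * N))) * ((m : ℝ) * N) ^ 3 = ((m : ℝ) * N) ^ 3 * Real.exp (-(π * ((m : ℝ) * N))) :=
          mul_comm _ _
        _ ≤ _ := h3
        _ ≤ 1 := hfac
    have hsN : Real.sqrt N ≤ N := by rw [Real.sqrt_le_left hN0.le]; nlinarith
    have hsm : 1 ≤ Real.sqrt m := by rw [← Real.sqrt_one]; exact Real.sqrt_le_sqrt hm1
    calc Real.sqrt N * m * Real.exp (-(π * ((m : ℝ) * N))) ≤ N * m * (1 / ((m : ℝ) * N) ^ 3) := by gcongr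
      _ = 1 / ((m : ℝ) ^ 2 * N ^ 2) := by field_simp
      _ ≤ 1 / N := by
          rw [div_le_div_iff₀ (by positivity) hN0]; nlinarith [mul_pos hm0 hN0]
      _ ≤ Real.sqrt m / N := by gcongr
  calc A * (r / (1 - r) ^ 2) ≤ A * (4 * r) := mul_le_mul_of_nonneg_left hgeom hA0
    _ = 4 * ((1 + K) * (Real.sqrt N * m * T)) * (Real.exp (2 * π) * r) := by rw [hA]; ring
    _ = 4 * ((1 + K) * (Real.sqrt N * m * T)) := by
        rw [hr, ← Real.exp_add, add_neg_cancel, Real.exp_zero, mul_one]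
    _ ≤ 4 * ((1 + K) * (Real.sqrt N * m * (2 ^ k * (1 + (k.factorial : ℝ)) * (1 + L) ^ k *
          Real.exp (-(π * ((m : ℝ) * N)))))) := by gcongr
    _ = 4 * (1 + K) * (2 ^ k * (1 + (k.factorial : ℝ))) * (1 + L) ^ k *
          (Real.sqrt N * m * Real.exp (-(π * ((m : ℝ) * N)))) := by ring
    _ ≤ 4 * (1 + K) * (2 ^ k * (1 + (k.factorial : ℝ))) * (1 + L) ^ k * (Real.sqrt m / N) := by gcongr
    _ = _ := by ring

/-! ## §2. The diagonal term -/

/-- **The diagonal at Bettin's height**: `2π q̂^{1/2} · √m I_k(m, 1/(mN²)) = q̂^{1/2} m^{−1/2} ∫_{2π/N²}^∞ e^{−x}(log(q̂/m)+log x)^k dx`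
(substitution `x = 2πm v`, `integral_Ioi_exp_comp_logWeight`). [cite: KowalskiMichelVanderKam2000, (14), (16) p. 9–11] -/
theorem diag_axisWeight_eq {N : ℕ} [NeZero N] {m : ℕ} (hm : 1 ≤ m) (k : ℕ) :
    2 * (π : ℂ) * ((KMV2000.qhat N : ℝ) : ℂ) ^ (1 / 2 : ℂ) * (((Real.sqrt m : ℝ) : ℂ) *
        ((∫ v in Ioi (1 / ((m : ℝ) * (N : ℝ) ^ 2)), Real.exp (-(2 * Real.pi * m) * v) *
          (Real.log (Real.sqrt N * v)) ^ k : ℝ) : ℂ)) =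
      ((KMV2000.qhat N : ℝ) : ℂ) ^ (1 / 2 : ℂ) * (((m : ℝ) ^ (-(1 / 2 : ℝ)) : ℝ) : ℂ) *
        ((∫ x in Ioi (2 * π / (N : ℝ) ^ 2), Real.exp (-x) * (Real.log (KMV2000.qhat N / m) + Real.log x) ^ k : ℝ) : ℂ) := by
  have hN0 : (0 : ℝ) < N := by exact_mod_cast NeZero.pos N
  have hm0 : (0 : ℝ) < m := by exact_mod_cast hm
  have hy : 0 < 1 / ((m : ℝ) * (N : ℝ) ^ 2) := by positivity
  have h := integral_Ioi_exp_comp_logWeight (N := N) (n := m) (by omega) hy (fun u ↦ u ^ k)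
  have ha : 2 * π * (m : ℝ) * (1 / ((m : ℝ) * (N : ℝ) ^ 2)) = 2 * π / (N : ℝ) ^ 2 := by field_simp
  rw [ha] at h
  rw [h]
  have hsqrt : Real.sqrt m * (2 * π * (m : ℝ))⁻¹ = (2 * π)⁻¹ * (m : ℝ) ^ (-(1 / 2 : ℝ)) := by
    rw [Real.sqrt_eq_rpow, show (-(1 / 2 : ℝ)) = (1 / 2 : ℝ) - 1 by norm_num, Real.rpow_sub_one hm0.ne']
    field_simp
  set J := ∫ x in Ioi (2 * π / (N : ℝ) ^ 2), Real.exp (-x) * (Real.log (KMV2000.qhat N / m) + Real.log x) ^ k with hJ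
  have hreal : 2 * π * (Real.sqrt m * ((2 * π * (m : ℝ))⁻¹ * J)) = (m : ℝ) ^ (-(1 / 2 : ℝ)) * J := by
    rw [← mul_assoc (Real.sqrt m), hsqrt]; field_simp
  have hc := congrArg (fun x : ℝ ↦ (x : ℂ)) hreal
  push_cast at hc ⊢
  linear_combination ((KMV2000.qhat N : ℝ) : ℂ) ^ (1 / 2 : ℂ) * hc

/-! ## §3. The order-`k` twisted harmonic first moment -/

/-- `‖2π q̂^{1/2}‖ = 2π √q̂`. -/
theorem norm_twoPi_mul_qhat_cpow (N : ℕ) [NeZero N] :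
    ‖2 * (π : ℂ) * ((KMV2000.qhat N : ℝ) : ℂ) ^ (1 / 2 : ℂ)‖ = 2 * π * Real.sqrt (KMV2000.qhat N) := by
  have hq := qhat_pos_of_neZero N
  rw [norm_mul, norm_mul, Complex.norm_cpow_eq_rpow_re_of_pos hq, Complex.norm_real, Real.norm_of_nonneg Real.pi_pos.le,
    Real.sqrt_eq_rpow]
  norm_num

set_option maxHeartbeats 400000 in
/-- **The twisted harmonic first moment of `Λ^{(k)}(f,½)` at prime level, every order `k`** (Bettin's range `m ≤ N`):
there is `C_k` with, for all primes `N` and all `1 ≤ m ≤ N`,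
`‖Σʰ_f λ_f(m) Λ^{(k)}(f,½) − q̂^{1/2} m^{−1/2} ∫_{2π/N²}^∞ e^{−x}(log(q̂/m)+log x)^k dx‖ ≤ C_k (1 + log N)^{k+4} q̂^{1/2} √m / N`.
At `k = 0` the main term is `q̂^{1/2} m^{−1/2}(1 − O(N^{−2}))` and this is Bettin 2017, Thm. 1.1 at prime level for `m ≤ N`
(times `q̂^{1/2} = Λ(f,½)/L(f,½)`). [cite: Bettin2017, Thm. 1.1 and §2] [cite: KowalskiMichelVanderKam2000, (13)–(16)] -/
theorem harmonicSum_heckeLambda_mul_derivLambda_sub_le (k : ℕ) :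
    ∃ C : ℝ, 0 ≤ C ∧ ∀ (N : ℕ) [NeZero N], N.Prime → ∀ m : ℕ, 1 ≤ m → m ≤ N →
      ‖GL2Family.harmonicSum N 2 (fun f ↦ GL2Family.heckeLambda f m * derivLambda N k f) -
          ((KMV2000.qhat N : ℝ) : ℂ) ^ (1 / 2 : ℂ) * (((m : ℝ) ^ (-(1 / 2 : ℝ)) : ℝ) : ℂ) *
            ((∫ x in Ioi (2 * π / (N : ℝ) ^ 2), Real.exp (-x) * (Real.log (KMV2000.qhat N / m) + Real.log x) ^ k : ℝ) : ℂ)‖ ≤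
        C * (1 + Real.log N) ^ (k + 4) * Real.sqrt (KMV2000.qhat N) * Real.sqrt m / N := by
  obtain ⟨C₁, hC₁0, hOD⟩ := norm_tsum_sqrt_petJ_axisWeight_le k
  obtain ⟨C₂, hC₂0, hDU⟩ := norm_tsum_dual_axisWeight_le k
  refine ⟨2 * π * (C₁ + C₂), by positivity, fun N _ hN m hm hmN ↦ ?_⟩
  have hN2 : (2 : ℝ) ≤ N := by exact_mod_cast hN.two_le
  have hN0 : (0 : ℝ) < N := by linarith
  have hm0 : (0 : ℝ) < m := by exact_mod_cast hm
  have hL0 : 0 < Real.log N := Real.log_pos (by linarith)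
  have hy : 0 < 1 / ((m : ℝ) * (N : ℝ) ^ 2) := by positivity
  -- the pieces
  have hS := harmonicSum_heckeLambda_mul_derivLambda_eq hN m k hy
  have hT1 := hasSum_harmonicSum_heckeLambda_mul_axisIntegral (N := N) m k hy
  set c : ℂ := 2 * (π : ℂ) * ((KMV2000.qhat N : ℝ) : ℂ) ^ (1 / 2 : ℂ) with hc
  set Iw : ℕ → ℂ := fun n ↦ ((∫ v in Ioi (1 / ((m : ℝ) * (N : ℝ) ^ 2)), Real.exp (-(2 * Real.pi * n) * v) *
    (Real.log (Real.sqrt N * v)) ^ k : ℝ) : ℂ) with hIw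
  -- Petersson: `Σ √n pet I = √m I(m) − Σ √n J I`
  have hD : HasSum (fun n : ℕ ↦ if n = m then ((Real.sqrt m : ℝ) : ℂ) * Iw m else 0) (((Real.sqrt m : ℝ) : ℂ) * Iw m) :=
    hasSum_ite_eq m _
  have hQ : HasSum (fun n : ℕ ↦ ((Real.sqrt n : ℝ) : ℂ) * petJ N m n * Iw n)
      (((Real.sqrt m : ℝ) : ℂ) * Iw m - GL2Family.harmonicSum N 2 (fun f ↦ GL2Family.heckeLambda f m *
        ∫ (v : ℝ) in Ioi (1 / ((m : ℝ) * (N : ℝ) ^ 2)), f (UpperHalfPlane.ofComplex (Complex.I * v)) *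
          (((Real.log (Real.sqrt N * v)) ^ k : ℝ) : ℂ))) := by
    refine (hD.sub hT1).congr_fun fun n ↦ ?_
    rcases Nat.eq_zero_or_pos n with rfl | hn
    · have h0 : (0 : ℕ) ≠ m := by omega
      simp [h0]
    · rw [(kowalskiMichel2000_peterssonFormula_holds N hN m n hm hn).2]
      by_cases hnm : n = m
      · subst hnm; rw [if_pos rfl, if_pos rfl]; ring
      · rw [if_neg hnm, if_neg (Ne.symm hnm)]; ring
  have hT1eq : ∑' n : ℕ, ((Real.sqrt n : ℝ) : ℂ) * pet N m n * Iw n =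
      ((Real.sqrt m : ℝ) : ℂ) * Iw m - ∑' n : ℕ, ((Real.sqrt n : ℝ) : ℂ) * petJ N m n * Iw n := by
    rw [hT1.tsum_eq, hQ.tsum_eq]; ring
  -- the diagonal is the main term
  have hdiag := diag_axisWeight_eq (N := N) hm k
  -- assemble: `S − main = −c Σ√nJI + c (−1)^k T₂`
  have hOD' := hOD N hN m hm hmN
  have hDU' := hDU N hN m hm hmN
  have hcn : ‖c‖ = 2 * π * Real.sqrt (KMV2000.qhat N) := norm_twoPi_mul_qhat_cpow N
  have hkey : GL2Family.harmonicSum N 2 (fun f ↦ GL2Family.heckeLambda f m * derivLambda N k f) -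
      ((KMV2000.qhat N : ℝ) : ℂ) ^ (1 / 2 : ℂ) * (((m : ℝ) ^ (-(1 / 2 : ℝ)) : ℝ) : ℂ) *
        ((∫ x in Ioi (2 * π / (N : ℝ) ^ 2), Real.exp (-x) * (Real.log (KMV2000.qhat N / m) + Real.log x) ^ k : ℝ) : ℂ) =
      -(c * ∑' n : ℕ, ((Real.sqrt n : ℝ) : ℂ) * petJ N m n * Iw n) +
        c * ((-1 : ℂ) ^ k * ∑' n : ℕ, ((Real.sqrt ((N : ℝ) * n) : ℝ) : ℂ) * pet N m (N * n) *
          ((∫ v in Ioi (((N : ℝ) * (1 / ((m : ℝ) * (N : ℝ) ^ 2)))⁻¹), Real.exp (-(2 * Real.pi * n) * v) *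
            (Real.log (Real.sqrt N * v)) ^ k : ℝ) : ℂ)) := by
    rw [hS, ← hdiag]
    simp only [← hc, hIw] at hT1eq ⊢
    rw [hT1eq]
    ring
  rw [hkey]
  have h1L : (1 : ℝ) ≤ 1 + Real.log N := by linarith
  have hpow : (1 + Real.log N) ^ k ≤ (1 + Real.log N) ^ (k + 4) := pow_le_pow_right₀ h1L (by omega)
  calc ‖-(c * ∑' n : ℕ, ((Real.sqrt n : ℝ) : ℂ) * petJ N m n * Iw n) +
        c * ((-1 : ℂ) ^ k * ∑' n : ℕ, ((Real.sqrt ((N : ℝ) * n) : ℝ) : ℂ) * pet N m (N * n) *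
          ((∫ v in Ioi (((N : ℝ) * (1 / ((m : ℝ) * (N : ℝ) ^ 2)))⁻¹), Real.exp (-(2 * Real.pi * n) * v) *
            (Real.log (Real.sqrt N * v)) ^ k : ℝ) : ℂ))‖
      ≤ ‖c‖ * ‖∑' n : ℕ, ((Real.sqrt n : ℝ) : ℂ) * petJ N m n * Iw n‖ +
          ‖c‖ * (‖(-1 : ℂ) ^ k‖ * ‖∑' n : ℕ, ((Real.sqrt ((N : ℝ) * n) : ℝ) : ℂ) * pet N m (N * n) *
            ((∫ v in Ioi (((N : ℝ) * (1 / ((m : ℝ) * (N : ℝ) ^ 2)))⁻¹), Real.exp (-(2 * Real.pi * n) * v) *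
              (Real.log (Real.sqrt N * v)) ^ k : ℝ) : ℂ)‖) := by
        refine (norm_add_le _ _).trans (add_le_add ?_ ?_)
        · rw [norm_neg, norm_mul c]
        · rw [norm_mul c, norm_mul ((-1 : ℂ) ^ k)]
    _ ≤ (2 * π * Real.sqrt (KMV2000.qhat N)) * (C₁ * (1 + Real.log N) ^ (k + 4) * Real.sqrt m / N) +
          (2 * π * Real.sqrt (KMV2000.qhat N)) * (1 * (C₂ * (1 + Real.log N) ^ k * Real.sqrt m / N)) := by
        rw [hcn, norm_pow, norm_neg, norm_one, one_pow]
        gcongr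
    _ ≤ (2 * π * Real.sqrt (KMV2000.qhat N)) * (C₁ * (1 + Real.log N) ^ (k + 4) * Real.sqrt m / N) +
          (2 * π * Real.sqrt (KMV2000.qhat N)) * (1 * (C₂ * (1 + Real.log N) ^ (k + 4) * Real.sqrt m / N)) := by
        gcongr
    _ = 2 * π * (C₁ + C₂) * (1 + Real.log N) ^ (k + 4) * Real.sqrt (KMV2000.qhat N) * Real.sqrt m / N := by ring

end Summit.Parity.GeneralizedHardyLittlewood.Theorems.MomentsBeyondDiagonal.FirstOrderAFE

end
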